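import Mathlib
import HarnessLib
import Summits.HubbardSuperconductivity.HubbardSuperconductivity.Theorems.KLProgrammeKLRegimeSplitPhValueExchangeBound
import Summits.HubbardSuperconductivity.HubbardSuperconductivity.Theorems.KLProgrammeKLRegimeSplitPhValueExchangeData

/-!
# Route `KLProgramme` — ENGINE (stmt-HubbardSuperconductivity-20437 `KLRegimeEngineV17F2`), row (c) binder #8 (★ v19 `hexLadMV`), EXCHANGE row `RQ` — TURNKEY form above the thermal
# layer: `klph_exchangeRow_diag_le_of_moduli` (O6h-b) with its three closer-side data DISCHARGED by O6h-c (`G₊ = 4/Λ(t)`, `εΦ = (128/Λ(t)²)·(2π/β)·(2Λ(t) + 2π/β)`,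
# `N_sh ≤ (Λ(t)β/π + 1)·(2200·4Λₙ·L² + 200000·L)`), leaving ONLY the E1 data `V₀, δ, F∞` of the kernel product — brick O6h-d
# (cell gate-hubbard-kl, seat hubbard-kl-k3c2-p2 g32, technique «thermal-bar induction n ≤ nScales β + 1 with EngineBoundsAtV4S sums»)

WHY.  E1-LEDGER rev 14 line #8: the `RQ` value row of binder #8 at the exchange diagonal `Qm = x + y` = rotation (thermal + DOS-slope + lattice) + moduli (`2¹⁰·15367·δ`) + a
one-more-rung correction `∝ (2π/β)/Λ(t)` = THERMAL.  This corollary is the closer's one-call form in the regime `16π/β ≤ Λ(t)` (every scale `n ≤ n_β − 2` of the extended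
ladder; the last three scales have `thermalBar ≥ 2⁷⁸(KlamU)²` and take the sign-blind route), on an admissible frame with `L ≥ 2¹⁵`, `1 ≤ n`:

* **`klph_exchangeRow_diag_le_regime`** — hypotheses: C4a chart (rotation), `FrameOK R U N μ K`, `klBetaMin ≤ β ≤ L`, `j ≥ n+1`, `t ∈ [0,1]`, `βΛ(t)/(2π) + 1 ≤ M`, the two
  shift maps (`klph_exists_shiftIdx` / `klph_exists_upShiftIdx`), E1 data `‖F p⁺ p − V₀ 0‖, ‖F p p⁻ − V₀ 1‖ ≤ δ`, `‖F p⁺ p‖, ‖F p p⁻‖ ≤ F∞` on the hard shell, and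
  `16π/β ≤ Λ(t)`, `2¹⁵ ≤ L`, `1 ≤ n`; conclusion: `(Λₙ−Λₙ₊₁)((βL²)³)⁻¹·‖hQ object‖ ≤ (Λₙ−Λₙ₊₁)·‖Σ_σV₀ σ‖·𝔅₆_b(Λ(t)) + 2¹⁰·15367·δ
  + (Λₙ−Λₙ₊₁)·((Λ(t)β/π + 1)(2200·4Λₙ·L² + 200000·L))·(βL²)⁻¹·(128/3)Λ(t)⁻²·2·(2/Λ(t))·((2π/β)(4/Λ(t)) + (128/Λ(t)²)(2π/β)(2Λ(t) + 2π/β))·F∞`.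
By value (the two hands' currencies): the last term is `≲ 2²⁸·F∞·(π/β)/Λ(t)` = `thermalBar`-class with `F∞ = (c₄U)²` (room ≥ 2⁵⁰ in `CF = 2⁸⁰klTS`).  Pure composition; no definitions;
nothing asserts (c), K3 or superconductivity.  [cite: BenfattoGiulianiMastropietro2006, §2.5]
-/

noncomputable section

namespace Summit.HubbardSuperconductivity.HubbardSuperconductivity.Theorems.KLRegimeSplit

set_option linter.dupNamespace false -- summit = problem name (single-conjunct summit), D-0017

open Real Set Finset Literature.MathematicalPhysics.QuantumLattice
open Literature.Probability.LatticeModels hiding torusSupNorm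
open Literature.MathematicalPhysics.QuantumLattice.BandSectorCounting
open Summit.HubbardSuperconductivity.HubbardSuperconductivity.Theorems.TwoPointAssembly
open Summit.HubbardSuperconductivity.HubbardSuperconductivity.Theorems.KLProgrammeLegKernels
open Summit.HubbardSuperconductivity.HubbardSuperconductivity.Theorems.KLRegimeWick
open Summit.HubbardSuperconductivity.HubbardSuperconductivity.Theorems.EngineV8
open Summit.HubbardSuperconductivity.HubbardSuperconductivity.Theorems.DispersionFlow
open Summit.HubbardSuperconductivity.HubbardSuperconductivity.Theorems.PerturbedFermiCurve

variable {L M : ℕ} [NeZero L] [NeZero M]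

section Regime

variable {R : RenConsts} {U : ℝ} {N : ℕ}

/-- **THE EXCHANGE p-h ROW AT ITS DIAGONAL, TURNKEY ABOVE THE THERMAL LAYER** (module docstring). [cite: BenfattoGiulianiMastropietro2006, §2.5] -/
theorem klph_exchangeRow_diag_le_regime {β μ : ℝ} {K : TrigPolyC4v} (hK : FrameOK R U N μ K) (hβ : klBetaMin ≤ β) (hβL : β ≤ L)
    {a b : ℝ} (B : BandBounds a b) {A : ℝ} (hA : ∀ p : Momentum, ∀ j ≤ 2, ‖iteratedFDeriv ℝ j (frameShift K) p‖ ≤ A) (hADt : 2 * A < B.Dtmin)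
    {r : ℝ} (hlo : a < μ - r - A) (hhi : μ + r + A < b) (n : ℕ) {t : ℝ} (ht : t ∈ Icc (0 : ℝ) 1)
    (Φ : ℕ → ℝ → FreqMomentum L M → ℝ) (hΦ : Φ = fun j t k => (softSymbolCompl L M β μ K (n + 1) j) k + (hubbardCutoffWeightCT L M β μ K (klScale klE0 (n + 1)) k -
            hubbardCutoffWeightCT L M β μ K (klScale klE0 n + t * (klScale klE0 (n + 1) - klScale klE0 n)) k))
    (Wd : ℝ → FreqMomentum L M → ℝ) (hWd : Wd = fun t k => deriv (fun Λ' : ℝ => hubbardCutoffWeightCT L M β μ K Λ' k) (klScale klE0 n + t * (klScale klE0 (n + 1) - klScale klE0 n)))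
    {j : ℕ} (hj : n + 1 ≤ j) (hΛr : klScale klE0 n + t * (klScale klE0 (n + 1) - klScale klE0 n) < r)
    (hM : β * (klScale klE0 n + t * (klScale klE0 (n + 1) - klScale klE0 n)) / (2 * Real.pi) + 1 ≤ M)
    {Mg ℓ r₁ : ℝ} (hr₁ : 0 < r₁)
    (hbd : ∀ s, |klWd (klScale klE0 n + t * (klScale klE0 (n + 1) - klScale klE0 n)) s *
      klPhi (klScale klE0 j) (klScale klE0 n + t * (klScale klE0 (n + 1) - klScale klE0 n)) s| ≤ Mg)
    (hlip : ∀ s s', |klWd (klScale klE0 n + t * (klScale klE0 (n + 1) - klScale klE0 n)) s *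
        klPhi (klScale klE0 j) (klScale klE0 n + t * (klScale klE0 (n + 1) - klScale klE0 n)) s -
      klWd (klScale klE0 n + t * (klScale klE0 (n + 1) - klScale klE0 n)) s' *
        klPhi (klScale klE0 j) (klScale klE0 n + t * (klScale klE0 (n + 1) - klScale klE0 n)) s'| ≤ ℓ * |s - s'|)
    (hin : ∀ s, s ≤ r₁ ^ 2 → klWd (klScale klE0 n + t * (klScale klE0 (n + 1) - klScale klE0 n)) s *
      klPhi (klScale klE0 j) (klScale klE0 n + t * (klScale klE0 (n + 1) - klScale klE0 n)) s = 0)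
    (hout : ∀ s, (klScale klE0 n + t * (klScale klE0 (n + 1) - klScale klE0 n)) ^ 2 ≤ s →
      klWd (klScale klE0 n + t * (klScale klE0 (n + 1) - klScale klE0 n)) s *
        klPhi (klScale klE0 j) (klScale klE0 n + t * (klScale klE0 (n + 1) - klScale klE0 n)) s = 0)
    {σ τ : MatsubaraIdx M → MatsubaraIdx M}
    (hσ : ∀ ν : MatsubaraIdx M, (ν : ℕ) ≠ 0 → matsubaraInt M (σ ν) = matsubaraInt M ν - 1) (hσ0 : ∀ ν : MatsubaraIdx M, (ν : ℕ) = 0 → σ ν = ν)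
    (hτ : ∀ ν : MatsubaraIdx M, (ν : ℕ) ≠ 2 * M - 1 → matsubaraInt M (τ ν) = matsubaraInt M ν + 1) (hτ0 : ∀ ν : MatsubaraIdx M, (ν : ℕ) = 2 * M - 1 → τ ν = ν)
    (F : FreqMomentum L M → FreqMomentum L M → ℂ) (V₀ : Fin 2 → ℂ) {δ Finf : ℝ} (hδ0 : 0 ≤ δ) (hF0 : 0 ≤ Finf)
    (hδ : ∀ p : FreqMomentum L M, Wd t p ≠ 0 → ‖F (τ p.1, p.2) p - V₀ 0‖ ≤ δ ∧ ‖F p (σ p.1, p.2) - V₀ 1‖ ≤ δ)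
    (hF : ∀ p : FreqMomentum L M, Wd t p ≠ 0 → ‖F (τ p.1, p.2) p‖ ≤ Finf ∧ ‖F p (σ p.1, p.2)‖ ≤ Finf)
    (h16 : 16 * π / β ≤ klScale klE0 n + t * (klScale klE0 (n + 1) - klScale klE0 n)) (hL15 : (2 : ℝ) ^ 15 ≤ L) (hn1 : 1 ≤ n)
    {Qm x y : TorusSite 2 L} (hxy : Qm = x + y) :
    (klScale klE0 n - klScale klE0 (n + 1)) * ((β * (L : ℝ) ^ 2) ^ 3)⁻¹ *
      ‖∑ p : FreqMomentum L M, ∑ p' : FreqMomentum L M,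
        (if matsubaraInt M p'.1 + matsubaraInt M (omega0 M) + matsubaraInt M (omega0 M) + 1 = matsubaraInt M p.1 ∧ p'.2 = p.2 + Qm - x - y then
          (((((Φ j t p) : ℝ) : ℂ) * (((β * (L : ℝ) ^ 2 : ℝ) : ℂ) * propCT L M β μ K p)) * ((((Wd t p') : ℝ) : ℂ) * (((β * (L : ℝ) ^ 2 : ℝ) : ℂ) * propCT L M β μ K p')) +
            ((((Wd t p) : ℝ) : ℂ) * (((β * (L : ℝ) ^ 2 : ℝ) : ℂ) * propCT L M β μ K p)) * ((((Φ j t p') : ℝ) : ℂ) * (((β * (L : ℝ) ^ 2 : ℝ) : ℂ) * propCT L M β μ K p'))) *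
            F p p'
        else 0)‖ ≤
      (klScale klE0 n - klScale klE0 (n + 1)) * ‖∑ σ : Fin 2, V₀ σ‖ *
        (((2 * π) ^ 2)⁻¹ * (2 * π * (π * Real.sqrt 2 / (B.Dtmin - 2 * A)) *
              ((2 * (klScale klE0 n + t * (klScale klE0 (n + 1) - klScale klE0 n)) * (2 * (klScale klE0 n + t * (klScale klE0 (n + 1) - klScale klE0 n)) *
                (2 * (klScale klE0 n + t * (klScale klE0 (n + 1) - klScale klE0 n)) ^ 2 * (ℓ / r₁ ^ 4 + 2 * Mg / r₁ ^ 6) + (ℓ / r₁ ^ 2 + Mg / r₁ ^ 4)))) *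
                ((klScale klE0 n + t * (klScale klE0 (n + 1) - klScale klE0 n)) + 2 * Real.pi / β) / β) +
            β⁻¹ * (((klScale klE0 n + t * (klScale klE0 (n + 1) - klScale klE0 n)) * β / π + 1) *
              (2 * (klScale klE0 n + t * (klScale klE0 (n + 1) - klScale klE0 n)) *
                (2 * π * (1 / (B.Dtmin - 2 * A) ^ 2 + Real.pi * Real.sqrt 2 * (2 + 4 * A) / (B.Dtmin - 2 * A) ^ 3) *
                  (klScale klE0 n + t * (klScale klE0 (n + 1) - klScale klE0 n)) * (Mg / r₁ ^ 2))))) +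
          ((klScale klE0 n + t * (klScale klE0 (n + 1) - klScale klE0 n)) / π + 3 / β) *
            (2 * π * (2 * (klScale klE0 n + t * (klScale klE0 (n + 1) - klScale klE0 n)) *
              (2 * (klScale klE0 n + t * (klScale klE0 (n + 1) - klScale klE0 n)) ^ 2 * (ℓ / r₁ ^ 4 + 2 * Mg / r₁ ^ 6) + (ℓ / r₁ ^ 2 + Mg / r₁ ^ 4)) *
              (4 + 2 * A)) / L)) +
        (2 : ℝ) ^ 10 * 15367 * δ +
        (klScale klE0 n - klScale klE0 (n + 1)) *
            (((klScale klE0 n + t * (klScale klE0 (n + 1) - klScale klE0 n)) * β / π + 1) * (2200 * (4 * klScale klE0 n) * (L : ℝ) ^ 2 + 200000 * L)) *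
            (β * (L : ℝ) ^ 2)⁻¹ *
          ((128 / 3 / (klScale klE0 n + t * (klScale klE0 (n + 1) - klScale klE0 n)) ^ 2) *
            (2 * ((2 / (klScale klE0 n + t * (klScale klE0 (n + 1) - klScale klE0 n))) *
              ((2 * π / β) * (4 / (klScale klE0 n + t * (klScale klE0 (n + 1) - klScale klE0 n))) +
                128 / (klScale klE0 n + t * (klScale klE0 (n + 1) - klScale klE0 n)) ^ 2 *
                  ((2 * π / β) * (2 * (klScale klE0 n + t * (klScale klE0 (n + 1) - klScale klE0 n)) + 2 * π / β)))) * Finf)) := by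
  have hβ0 : 0 < β := pos_of_klBetaMin_le hβ
  have hL : (0 : ℝ) < L := hβ0.trans_le hβL
  have hβL2 : 0 < β * (L : ℝ) ^ 2 := by positivity
  have h10 := (klmf_klScale_succ_pos_le n).2
  have h1 := (klmf_klScale_succ_pos_le n).1
  have hmem := klws_affine_mem_Icc h10 ht
  set Λt : ℝ := klScale klE0 n + t * (klScale klE0 (n + 1) - klScale klE0 n) with hΛt_def
  have hΛt : 0 < Λt := h1.trans_le hmem.1
  have hdiff : 0 ≤ klScale klE0 n - klScale klE0 (n + 1) := by linarith
  have hq0 : 0 ≤ 2 * π / β := by positivity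
  have h8 : 8 * (2 * π / β) ≤ Λt := by have := h16; rw [hΛt_def]; linarith [show 8 * (2 * π / β) = 16 * π / β by ring]
  -- the data of O6h-b from O6h-c
  have hG : ∀ p : FreqMomentum L M, Wd t p ≠ 0 → ‖propCT L M β μ K (τ p.1, p.2)‖ ≤ 4 / Λt ∧ ‖propCT L M β μ K (σ p.1, p.2)‖ ≤ 4 / Λt := by
    intro p hp
    rw [hWd] at hp
    exact ⟨klph_norm_propCT_shift_le β μ K hΛt hp (klph_abs_upShift_freq_sub_le hτ hβ0 hτ0 p.1) h8,
      klph_norm_propCT_shift_le β μ K hΛt hp (klph_abs_shift_freq_sub_le hβ0 hσ hσ0 p.1) h8⟩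
  have hΛj : 0 < klScale klE0 j := klth_klScale_pos j
  have hE0 : (0 : ℝ) ≤ klE0 := by norm_num [klE0]
  have hjle : klScale klE0 j ≤ Λt := (EngineV8.klScale_le_klScale hE0 hj).trans hmem.1
  have hε : ∀ p : FreqMomentum L M, Wd t p ≠ 0 →
      |Φ j t (τ p.1, p.2) - Φ j t p| ≤ 128 / Λt ^ 2 * ((2 * π / β) * (2 * Λt + 2 * π / β)) ∧
        |Φ j t (σ p.1, p.2) - Φ j t p| ≤ 128 / Λt ^ 2 * ((2 * π / β) * (2 * Λt + 2 * π / β)) := by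
    intro p hp
    rw [hWd] at hp
    rw [hΦ]
    exact ⟨klph_memberSymbol_shift_le β μ K n j hΛj hjle hp hq0 (klph_abs_upShift_freq_sub_le hτ hβ0 hτ0 p.1) h8,
      klph_memberSymbol_shift_le β μ K n j hΛj hjle hp hq0 (klph_abs_shift_freq_sub_le hβ0 hσ hσ0 p.1) h8⟩
  have hmain := klph_exchangeRow_diag_le_of_moduli (L := L) (M := M) hK hβ hβL B hA hADt hlo hhi n ht Φ hΦ Wd hWd hj hΛr hM hr₁ hbd hlip hin hout hσ hσ0 hτ hτ0
    F V₀ hδ0 hF0 (by positivity : (0 : ℝ) ≤ 4 / Λt) (by positivity : (0 : ℝ) ≤ 128 / Λt ^ 2 * ((2 * π / β) * (2 * Λt + 2 * π / β))) hδ hF hG hε hxy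
  -- the count
  have hcard : ((univ.filter fun p : FreqMomentum L M => Wd t p ≠ 0).card : ℝ) ≤ (Λt * β / π + 1) * (2200 * (4 * klScale klE0 n) * (L : ℝ) ^ 2 + 200000 * L) := by
    have h := klph_card_hardShell_le (L := L) (M := M) hK hL15 hβ0 hn1 hΛt hmem.2
    rw [hWd]
    exact h
  have hrest : 0 ≤ (β * (L : ℝ) ^ 2)⁻¹ * ((128 / 3 / Λt ^ 2) * (2 * ((2 / Λt) * ((2 * π / β) * (4 / Λt) + 128 / Λt ^ 2 * ((2 * π / β) * (2 * Λt + 2 * π / β)))) * Finf)) := by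
    positivity
  have hmono : (klScale klE0 n - klScale klE0 (n + 1)) * ((univ.filter fun p : FreqMomentum L M => Wd t p ≠ 0).card : ℝ) * (β * (L : ℝ) ^ 2)⁻¹ *
        ((128 / 3 / Λt ^ 2) * (2 * ((2 / Λt) * ((2 * π / β) * (4 / Λt) + 128 / Λt ^ 2 * ((2 * π / β) * (2 * Λt + 2 * π / β)))) * Finf)) ≤
      (klScale klE0 n - klScale klE0 (n + 1)) * ((Λt * β / π + 1) * (2200 * (4 * klScale klE0 n) * (L : ℝ) ^ 2 + 200000 * L)) * (β * (L : ℝ) ^ 2)⁻¹ *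
        ((128 / 3 / Λt ^ 2) * (2 * ((2 / Λt) * ((2 * π / β) * (4 / Λt) + 128 / Λt ^ 2 * ((2 * π / β) * (2 * Λt + 2 * π / β)))) * Finf)) := by
    have := mul_le_mul_of_nonneg_left hcard hdiff
    have := mul_le_mul_of_nonneg_right this hrest
    simpa only [mul_assoc] using this
  linarith

end Regime

end Summit.HubbardSuperconductivity.HubbardSuperconductivity.Theorems.KLRegimeSplit

end
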